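import Summits.QuantumFields.YangMills.Theorems.BalabanUVNodesN11NoExpansionZetaSpecSucc

/-!
# DAG node N11 — THE NO-EXPANSION 𝐓-STEP AFTER AN ARBITRARY HISTORY, FOR ANY 𝐓-WEIGHT FAMILY: at a new sequence `s′` of length `k+1` with
# `Ω_{k+1}(s′) = ∅` (NO condition on `Ω_1, …, Ω_k`), the (3.25) identity one level up holds `dV′`-a.e. from (i) the §2 identity of `ρ_k`'s slot at `init s′`
# ON THE `χ_k`-SUPPORT, (ii) old-factor agreement (3.24), (iii) the generation-`k` ζ-SPEC CARRYING THE OLD FRONT FACTOR: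
# `ζ_k(T)·w_k(∅,∅,∅)(U,Ū) = c·χ_k(Ω_k(init s′))(U)·w_k(s′)(U,Ū)` — print's `T^{(k)}(Ω_{k+1}ᶜ, ζ)` absorbs `χ_k(Ω_k)` when `Ω_{k+1} = ∅`

Cell `pub-ymgap`, YM-PLAN Track A (HUMAN RULING D-0062), seat `pub-ymgap-dag-n11-d` (g8; R134 fan-out seat N11 [B14], strategy s2), route `BalabanUVNodes`
rev 23, item K1⁶ `StabilityBAtRecordR13SepCoPR` = stmt-QuantumFields-20507 (helper, count-neutral; ⁷ re-key by name at KEY-24).  [III] = [Balaban1988Convergent].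
Generalises this seat's `…NoExpansionZetaSpecSucc` (p527502, g7 file 4b), whose `hχ : χ_k(init s′) ≡ 1` restricted it to histories with `Ω_k(init s′) = ∅`
(referee ref-K READ-41 NIT N3 «strong declared pin»); over g3's generic `Node00.TkNoExpansionStepSucc` (p485389) and 4b's §1 tools.

WHY THIS FILE.  N11's residue (S1ᵀ) at a witness is `∀ k < K, SLaw k → TLaw k`; its `TLaw k` quantifies over ALL new sequences of length `k+1`.  This seat's
g3–g8 files settle the ones with NO new small-field region (`Ω_{k+1} = ∅`) along the all-large-field DIAGONAL (old history all-large too).  The present file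
removes the restriction on the OLD history: after ANY admissible `(Ω_1, …, Ω_k; Λ_1, …, Λ_k)`, an all-large new step is reached by the same mechanism, with ONE
change — the old front factor `χ_k(Ω_k(init s′))(U)` no longer equals `1`, and (as in print, where the term's characteristic functions at step `k` become part
of the operation `T^{(k)}(Ω_{k+1}ᶜ, ζ)` on `Ω_{k+1}ᶜ = T`, [III] (2.20)–(2.22) p.258, (3.1) p.264) it is ABSORBED INTO THE GENERATION-`k` ζ-SPEC: the pin reads
`ζ_k(T)·w_k(∅,∅,∅)(U, Ū) = c·χ_k(init s′)(U)·w_k(s′)(U, Ū)` (12b-local: a function of the scale-`k` variables).  Under it the §2 identity at `init s′` is needed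
only where `χ_k ≠ 0` — exactly what `SLaw k`'s clause supplies — and OFF the support both transported integrands vanish.  The old-factor agreement (3.24) stays
DISPLAYED here (`hbranch`); the sequel `…NoExpansionOldFactors` derives it from (2.22) (p531413), def-R's no-expansion background (p526149), (L)+(SL) (p527289)
and the displayed scale-locality of the old operand's fluctuation argument, and instantiates the step at the v1.7 `CoPH` record.

WHAT THIS FILE PROVES (0 `sorry`, 0 `def`, standard axioms; `N`-generic; every `θ`, run, weight family `W`, witnesses).
★★ `slotsT_succ_ae_eq_sect2Slot_of_zetaSpecChiAt` — 4b WITHOUT `hχ ≡ 1`: hypotheses `hid` (identity on the `χ_k`-support at `init s′`), `hbranch` ((3.24), constant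
`κ`), `hζχ` (the spec with `χ_k`, constant `c`, `c·κ = 1`), displayed joint measurability ∕ bound of the new integrand per old branch and measurability of `χ_k(init s′)`;
conclusion: the (3.25) identity at `s′` a.e. on the `χ_{k+1}(s′)`-support · `hasSect2FormAtZ_clause_succ_of_zetaSpecChiAt` (the dichotomy clause, identity branch) ·
`clause_succ_of_zetaSpecChiAt_of_clause` (clause-keyed: the `slot_k(init s′) = 0` branch gives `slotT_{k+1}(s′) = 0`).

HONEST FRAMING.  Count-neutral kernel bookkeeping on the tree's OWN objects; a SUFFICIENT condition at ONE no-expansion new sequence after an arbitrary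
history, modulo the displayed (3.24) and the displayed spec (a HYPOTHESIS on the weight family — at the v1.7 record a statement about the VALUE of `θ.Zh`,
node00-def-K0a∕K0b's H3 lane; NOT supplied here) — NOT `TLaw k` (sequences with `Ω_{k+1}(s′) ≠ ∅` are [III] §3 + Thm 2 proper), NOT a witness.  Nothing of
Bałaban's asserted; N11 NOT discharged; counts unmoved (typed 28∕28 · discharged 5∕28).  One finite four-torus programme at fixed `ε = L^{−K}`; NOT ℝ⁴, NOT
OS, NOT a mass gap, NOT Clay.  Sources: [III] (2.18) p. 257, (2.20)–(2.23) p. 258, (3.1) p. 264, (3.16) p. 268, (3.24)–(3.25) p. 270, Theorem p. 245, Thm 1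
p. 262; [Balaban1985Averaging] (10) p. 19.
-/

noncomputable section

open MeasureTheory
open scoped BigOperators Matrix.Norms.L2Operator

namespace Summit.QuantumFields.YangMills.Theorems.BalabanUVNodesN11NoExpansionGeneralStep

open Literature.MathematicalPhysics.QuantumFieldTheory.Balaban1983to89 T4Continuum Node00 Node00.Tk DagBinding
open B15DeterminingSets
open BalabanUVNodesN11NoExpansionZetaSpecSucc (noExpIntegrandAt_eq_zetaFactor_mul integrable_section_of_measurable_bounded transportOfRecord_finset_sum)

variable {F : T4Family} {N : ℕ} [NeZero N]

section Positive

variable (θ : Stage13Params F N) (p : B12.RunParams)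

/-- **★★ THE (S1ᵀ)₁₃ IDENTITY AT A NO-EXPANSION NEW SEQUENCE AFTER AN ARBITRARY HISTORY, UNDER OLD-FACTOR AGREEMENT AND THE GENERATION-`k` ζ-SPEC WITH THE
OLD FRONT FACTOR — ANY WEIGHT FAMILY.**  Let `s′` have `Ω_{k+1}(s′) = ∅` (`k < K`; nothing asked of `Ω_1, …, Ω_k`), `W` any 𝐓-weight family, `(t, E_k, U_k)` a
§2 witness of `ρ_k`'s slot at `init s′` (identity a.e. ON THE `χ_k(init s′)`-SUPPORT — `hid`), and `(t′, E_{k+1}, U_{k+1})` the proposed witness at `s′`.  Suppose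
(ii) OLD-FACTOR AGREEMENT ((3.24)): for every old branch `S`, `𝐓_k(init s′,S)[e^{A_{k+1}(s′)}]_S (U, V′) = κ·𝐓_k(init s′,S)[e^{A_k(init s′)}]_S (U)`;
(iii) THE GENERATION-`k` SPEC WITH `χ_k` on the averaging graph: `ζ_k(T)(U,Ū)·w_k(∅,∅,∅)(U,Ū) = c·χ_k(init s′)(U)·w_k(s′)(U,Ū)`, `c·κ = 1`; the displayed
joint measurability ∕ bound of the new integrand per old branch.  Then `slotT_{k+1}(s′)(V′) = 𝐓_{k+1}(s′)e^{A_{k+1}(s′)}(V′)` for `dV′`-a.e. `V′` on the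
`χ_{k+1}(s′)`-support.  Proof: def-T's slot is `T_k[w_k(s′)·χ_k·slot_k(init s′)]` =ᵐ `T_k[w_k(s′)·χ_k·Σ_S 𝐓_k(init s′,S)e^{A_k}_S]` (`hid` on the support,
both sides `0` off it; `transportK_congr_ae_family`); 11a's slot is =ᵐ `Σ_S T_k[ζ_k w_k·𝐓_k(init s′,S)e^{A_{k+1}}_S]` (g3) `= T_k[Σ_S …]`; the two integrands AGREE
ON THE GRAPH `V′ = Ū` by (ii)–(iii); g3's `transportK_congr_ae_of_fibre` closes.
[cite: Balaban1988Convergent, Theorem p.245, (3.24)–(3.25) p.270, (2.18) p.257, (2.20)–(2.23) p.258, (3.1) p.264, (3.16) p.268] -/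
theorem slotsT_succ_ae_eq_sect2Slot_of_zetaSpecChiAt {k : ℕ} (hk : k < p.K)
    (s : SeqOfRecord F θ.ν θ.τ9.M (gOfRecord₁₃ F N θ p) p.K (k + 1)) (hΩ : s.Ω (k + 1) = ∅) (W : TkWeights F N (FluctV N) p.K)
    (Rz : Sect2.Residual (F.P p.K) (MatA N))
    (t : Sect2.TermValues (F.P p.K) (MatA N) (FluctV N) θ.τ9.M) (Ek : ℝ) (U : BgMap F N p.K)
    (hid : ∀ᵐ U₀ ∂fieldMeasure (F.P p.K) k (SU N),
      chiSeqOfRecord F N θ.ν θ.τ9.M (gOfRecord₁₃ F N θ p) p.K k s.init U₀ ≠ 0 →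
        slotsOfRecord F N θ.ν θ.τ9 (EOfRecord₁₃ F N θ) (wOfRecord₉ F N θ.toStage9Params) θ.ppSel p
            (gOfRecord₁₃ F N θ p) k s.init U₀ =
          sect2Slot F N (FluctV N) p.K (settingOfRecord₁₃ F N θ p) Rz W s.init t Ek U U₀)
    (Rz' : Sect2.Residual (F.P p.K) (MatA N))
    (t' : Sect2.TermValues (F.P p.K) (MatA N) (FluctV N) θ.τ9.M) (Ek' : ℝ) (U' : BgMap F N p.K)
    {κ c C : ℝ} (hcκ : c * κ = 1)
    (hbranch : ∀ S ∈ admSOfRecord F θ.ν θ.τ9.M (gOfRecord₁₃ F N θ p) p.K k s.init,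
      ∀ (V' : GaugeField (F.P p.K) (k + 1) (SU N)) (U₀ : GaugeField (F.P p.K) k (SU N)),
        tkBranchOfRecord F N (FluctV N) θ.ν θ.τ9.M _ p.K W s.init S k
            (fun ω => sect2Operand F N (FluctV N) p.K (settingOfRecord₁₃ F N θ p) Rz' s t' Ek' U' (S, fun j => (ω j).2) (fun j => (ω j).1))
            (pairCfgAt (V := FluctV N) k V' U₀) =
          κ * tkBranchOfRecord F N (FluctV N) θ.ν θ.τ9.M _ p.K W s.init S k
            (fun ω => sect2Operand F N (FluctV N) p.K (settingOfRecord₁₃ F N θ p) Rz s.init t Ek U (S, fun j => (ω j).2) (fun j => (ω j).1))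
            (baseCfg k U₀))
    (hζχ : ∀ U₀ : GaugeField (F.P p.K) k (SU N),
      W.ζ k Set.univ (pairCfgAt (V := FluctV N) k ((avOfRecord F N p.K k).avg U₀) U₀) *
          W.w k ∅ ∅ ∅ (pairCfgAt (V := FluctV N) k ((avOfRecord F N p.K k).avg U₀) U₀) =
        c * (chiSeqOfRecord F N θ.ν θ.τ9.M (gOfRecord₁₃ F N θ p) p.K k s.init U₀ *
          wOfRecord₉ F N θ.toStage9Params p (gOfRecord₁₃ F N θ p) k s U₀ ((avOfRecord F N p.K k).avg U₀)))
    (hm : ∀ S ∈ admSOfRecord F θ.ν θ.τ9.M (gOfRecord₁₃ F N θ p) p.K k s.init,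
      Measurable (Function.uncurry (noExpIntegrandAt F N (FluctV N) p.K k W
        (tkBranchOfRecord F N (FluctV N) θ.ν θ.τ9.M _ p.K W s.init S k
          (fun ω => sect2Operand F N (FluctV N) p.K (settingOfRecord₁₃ F N θ p) Rz' s t' Ek' U' (S, fun j => (ω j).2) (fun j => (ω j).1))))))
    (hC : ∀ S ∈ admSOfRecord F θ.ν θ.τ9.M (gOfRecord₁₃ F N θ p) p.K k s.init, ∀ V' U₀,
      |noExpIntegrandAt F N (FluctV N) p.K k W
        (tkBranchOfRecord F N (FluctV N) θ.ν θ.τ9.M _ p.K W s.init S k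
          (fun ω => sect2Operand F N (FluctV N) p.K (settingOfRecord₁₃ F N θ p) Rz' s t' Ek' U' (S, fun j => (ω j).2) (fun j => (ω j).1)))
        V' U₀| ≤ C) :
    ∀ᵐ V' ∂fieldMeasure (F.P p.K) (k + 1) (SU N),
      chiSeqOfRecord F N θ.ν θ.τ9.M (gOfRecord₁₃ F N θ p) p.K (k + 1) s V' ≠ 0 →
        slotsTOfRecord F N θ.ν θ.τ9 (EOfRecord₁₃ F N θ) (wOfRecord₉ F N θ.toStage9Params) θ.ppSel p
            (gOfRecord₁₃ F N θ p) (k + 1) s V' =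
          sect2Slot F N (FluctV N) p.K (settingOfRecord₁₃ F N θ p) Rz' W s t' Ek' U' V' := by
  classical
  -- abbreviations: the old branches of the old operand at the base configuration, and the new integrand per old branch
  set B : (ℕ → Set (Site (F.P p.K) 0)) → GaugeField (F.P p.K) k (SU N) → ℝ := fun S U₀ =>
    tkBranchOfRecord F N (FluctV N) θ.ν θ.τ9.M _ p.K W s.init S k
      (fun ω => sect2Operand F N (FluctV N) p.K (settingOfRecord₁₃ F N θ p) Rz s.init t Ek U (S, fun j => (ω j).2) (fun j => (ω j).1))
      (baseCfg k U₀) with hB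
  set G : (ℕ → Set (Site (F.P p.K) 0)) → GaugeField (F.P p.K) (k + 1) (SU N) → GaugeField (F.P p.K) k (SU N) → ℝ := fun S V' U₀ =>
    noExpIntegrandAt F N (FluctV N) p.K k W
      (tkBranchOfRecord F N (FluctV N) θ.ν θ.τ9.M _ p.K W s.init S k
        (fun ω => sect2Operand F N (FluctV N) p.K (settingOfRecord₁₃ F N θ p) Rz' s t' Ek' U' (S, fun j => (ω j).2) (fun j => (ω j).1)))
      V' U₀ with hG
  set A := admSOfRecord F θ.ν θ.τ9.M (gOfRecord₁₃ F N θ p) p.K k s.init with hA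
  set χk : GaugeField (F.P p.K) k (SU N) → ℝ := chiSeqOfRecord F N θ.ν θ.τ9.M (gOfRecord₁₃ F N θ p) p.K k s.init with hχk
  -- (1) def-T's slot: a.e. the transport of `w(s′)·χ_k·Σ_S B_S` (SLaw's identity at `init s′` ON the support; both sides vanish off it)
  have hsect : ∀ U₀ : GaugeField (F.P p.K) k (SU N),
      sect2Slot F N (FluctV N) p.K (settingOfRecord₁₃ F N θ p) Rz W s.init t Ek U U₀ = ∑ S ∈ A, B S U₀ :=
    fun U₀ => TkOfRecord_apply F N (FluctV N) θ.ν θ.τ9.M _ p.K W k s.init _ U₀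
  have h1 := transportK_congr_ae_family (avOfRecord_measurable F N p.K k) (avOfRecord_haarAC F N p.K k hk)
    (f := fun V' U₀ => wOfRecord₉ F N θ.toStage9Params p (gOfRecord₁₃ F N θ p) k s U₀ V' *
      (χk U₀ * slotsOfRecord F N θ.ν θ.τ9 (EOfRecord₁₃ F N θ) (wOfRecord₉ F N θ.toStage9Params) θ.ppSel p (gOfRecord₁₃ F N θ p) k s.init U₀))
    (g := fun V' U₀ => wOfRecord₉ F N θ.toStage9Params p (gOfRecord₁₃ F N θ p) k s U₀ V' * (χk U₀ * ∑ S ∈ A, B S U₀))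
    (hid.mono fun U₀ hU V' => by
      by_cases hne : χk U₀ = 0
      · simp only [hne, zero_mul, mul_zero]
      · rw [hU hne, hsect U₀])
  -- (2) 11a's slot: a.e. the sum over the old index of the transports of the new integrands (g3), = the transport of their sum (additivity)
  have h2 := TkOfRecord_succ_ae_eq_sum_transportOfRecord_of_Omega_empty θ.ν θ.τ9.M _ p.K W hk s hΩ
    (sect2Operand F N (FluctV N) p.K (settingOfRecord₁₃ F N θ p) Rz' s t' Ek' U') hm hC
  have hsum : ∀ V' : GaugeField (F.P p.K) (k + 1) (SU N),
      ∑ S ∈ A, transportOfRecord F N p.K k (G S V') V' = transportOfRecord F N p.K k (fun U₀ => ∑ S ∈ A, G S V' U₀) V' := fun V' =>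
    (transportOfRecord_finset_sum p k A (fun S => G S V') V'
      (fun S hS => integrable_section_of_measurable_bounded p k (hm S hS) (hC S hS) V')).symm
  -- (3) the two integrand families AGREE ON THE GRAPH `V′ = Ū`: old-factor agreement, the spec with `χ_k`, `c·κ = 1`
  have hfib : ∀ U₀ : GaugeField (F.P p.K) k (SU N),
      wOfRecord₉ F N θ.toStage9Params p (gOfRecord₁₃ F N θ p) k s U₀ ((avOfRecord F N p.K k).avg U₀) * (χk U₀ * ∑ S ∈ A, B S U₀) =
        ∑ S ∈ A, G S ((avOfRecord F N p.K k).avg U₀) U₀ := by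
    intro U₀
    rw [← mul_assoc, Finset.mul_sum]
    refine Finset.sum_congr rfl fun S hS => ?_
    simp only [hG, hB]
    rw [noExpIntegrandAt_eq_zetaFactor_mul, hζχ U₀, hbranch S hS]
    calc wOfRecord₉ F N θ.toStage9Params p (gOfRecord₁₃ F N θ p) k s U₀ ((avOfRecord F N p.K k).avg U₀) * χk U₀ *
          tkBranchOfRecord F N (FluctV N) θ.ν θ.τ9.M _ p.K W s.init S k
            (fun ω => sect2Operand F N (FluctV N) p.K (settingOfRecord₁₃ F N θ p) Rz s.init t Ek U (S, fun j => (ω j).2)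
              (fun j => (ω j).1)) (baseCfg k U₀)
        = (c * κ) * (wOfRecord₉ F N θ.toStage9Params p (gOfRecord₁₃ F N θ p) k s U₀ ((avOfRecord F N p.K k).avg U₀) * χk U₀ *
          tkBranchOfRecord F N (FluctV N) θ.ν θ.τ9.M _ p.K W s.init S k
            (fun ω => sect2Operand F N (FluctV N) p.K (settingOfRecord₁₃ F N θ p) Rz s.init t Ek U (S, fun j => (ω j).2)
              (fun j => (ω j).1)) (baseCfg k U₀)) := by rw [hcκ, one_mul]
      _ = c * (χk U₀ * wOfRecord₉ F N θ.toStage9Params p (gOfRecord₁₃ F N θ p) k s U₀ ((avOfRecord F N p.K k).avg U₀)) *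
          (κ * tkBranchOfRecord F N (FluctV N) θ.ν θ.τ9.M _ p.K W s.init S k
            (fun ω => sect2Operand F N (FluctV N) p.K (settingOfRecord₁₃ F N θ p) Rz s.init t Ek U (S, fun j => (ω j).2)
              (fun j => (ω j).1)) (baseCfg k U₀)) := by ring
  have h3 := transportK_congr_ae_of_fibre (avOfRecord_measurable F N p.K k) (avOfRecord_haarAC F N p.K k hk)
    (f := fun V' U₀ => wOfRecord₉ F N θ.toStage9Params p (gOfRecord₁₃ F N θ p) k s U₀ V' * (χk U₀ * ∑ S ∈ A, B S U₀))
    (g := fun V' U₀ => ∑ S ∈ A, G S V' U₀) hfib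
  -- (4) assemble
  filter_upwards [h1, h2, h3] with V' e1 e2 e3 _
  rw [slotsTOfRecord_succ_apply]
  show T4AveragingDisintegration.transportK (avOfRecord F N p.K k).avg _ V' = _
  rw [e1, e3]
  show transportOfRecord F N p.K k (fun U₀ => ∑ S ∈ A, G S V' U₀) V' = _
  rw [← hsum V']
  exact e2.symm

/-- **… HENCE THE DICHOTOMY CLAUSE AT `s′` ONE LEVEL UP** (identity branch), under the same hypotheses. [cite: Balaban1988Convergent, (2.17)–(2.18) p.257, (3.25) p.270] -/
theorem hasSect2FormAtZ_clause_succ_of_zetaSpecChiAt {k : ℕ} (hk : k < p.K)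
    (s : SeqOfRecord F θ.ν θ.τ9.M (gOfRecord₁₃ F N θ p) p.K (k + 1)) (hΩ : s.Ω (k + 1) = ∅) (W : TkWeights F N (FluctV N) p.K)
    (Rz : Sect2.Residual (F.P p.K) (MatA N))
    (t : Sect2.TermValues (F.P p.K) (MatA N) (FluctV N) θ.τ9.M) (Ek : ℝ) (U : BgMap F N p.K)
    (hid : ∀ᵐ U₀ ∂fieldMeasure (F.P p.K) k (SU N),
      chiSeqOfRecord F N θ.ν θ.τ9.M (gOfRecord₁₃ F N θ p) p.K k s.init U₀ ≠ 0 →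
        slotsOfRecord F N θ.ν θ.τ9 (EOfRecord₁₃ F N θ) (wOfRecord₉ F N θ.toStage9Params) θ.ppSel p
            (gOfRecord₁₃ F N θ p) k s.init U₀ =
          sect2Slot F N (FluctV N) p.K (settingOfRecord₁₃ F N θ p) Rz W s.init t Ek U U₀)
    (Rz' : Sect2.Residual (F.P p.K) (MatA N))
    (t' : Sect2.TermValues (F.P p.K) (MatA N) (FluctV N) θ.τ9.M) (Ek' : ℝ) (U' : BgMap F N p.K)
    {κ c C : ℝ} (hcκ : c * κ = 1)
    (hbranch : ∀ S ∈ admSOfRecord F θ.ν θ.τ9.M (gOfRecord₁₃ F N θ p) p.K k s.init,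
      ∀ (V' : GaugeField (F.P p.K) (k + 1) (SU N)) (U₀ : GaugeField (F.P p.K) k (SU N)),
        tkBranchOfRecord F N (FluctV N) θ.ν θ.τ9.M _ p.K W s.init S k
            (fun ω => sect2Operand F N (FluctV N) p.K (settingOfRecord₁₃ F N θ p) Rz' s t' Ek' U' (S, fun j => (ω j).2) (fun j => (ω j).1))
            (pairCfgAt (V := FluctV N) k V' U₀) =
          κ * tkBranchOfRecord F N (FluctV N) θ.ν θ.τ9.M _ p.K W s.init S k
            (fun ω => sect2Operand F N (FluctV N) p.K (settingOfRecord₁₃ F N θ p) Rz s.init t Ek U (S, fun j => (ω j).2) (fun j => (ω j).1))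
            (baseCfg k U₀))
    (hζχ : ∀ U₀ : GaugeField (F.P p.K) k (SU N),
      W.ζ k Set.univ (pairCfgAt (V := FluctV N) k ((avOfRecord F N p.K k).avg U₀) U₀) *
          W.w k ∅ ∅ ∅ (pairCfgAt (V := FluctV N) k ((avOfRecord F N p.K k).avg U₀) U₀) =
        c * (chiSeqOfRecord F N θ.ν θ.τ9.M (gOfRecord₁₃ F N θ p) p.K k s.init U₀ *
          wOfRecord₉ F N θ.toStage9Params p (gOfRecord₁₃ F N θ p) k s U₀ ((avOfRecord F N p.K k).avg U₀)))
    (hm : ∀ S ∈ admSOfRecord F θ.ν θ.τ9.M (gOfRecord₁₃ F N θ p) p.K k s.init,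
      Measurable (Function.uncurry (noExpIntegrandAt F N (FluctV N) p.K k W
        (tkBranchOfRecord F N (FluctV N) θ.ν θ.τ9.M _ p.K W s.init S k
          (fun ω => sect2Operand F N (FluctV N) p.K (settingOfRecord₁₃ F N θ p) Rz' s t' Ek' U' (S, fun j => (ω j).2) (fun j => (ω j).1))))))
    (hC : ∀ S ∈ admSOfRecord F θ.ν θ.τ9.M (gOfRecord₁₃ F N θ p) p.K k s.init, ∀ V' U₀,
      |noExpIntegrandAt F N (FluctV N) p.K k W
        (tkBranchOfRecord F N (FluctV N) θ.ν θ.τ9.M _ p.K W s.init S k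
          (fun ω => sect2Operand F N (FluctV N) p.K (settingOfRecord₁₃ F N θ p) Rz' s t' Ek' U' (S, fun j => (ω j).2) (fun j => (ω j).1)))
        V' U₀| ≤ C) :
    slotsTOfRecord F N θ.ν θ.τ9 (EOfRecord₁₃ F N θ) (wOfRecord₉ F N θ.toStage9Params) θ.ppSel p (gOfRecord₁₃ F N θ p) (k + 1) s = 0 ∨
      ∀ᵐ V' ∂fieldMeasure (F.P p.K) (k + 1) (SU N),
        chiSeqOfRecord F N θ.ν θ.τ9.M (gOfRecord₁₃ F N θ p) p.K (k + 1) s V' ≠ 0 →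
          slotsTOfRecord F N θ.ν θ.τ9 (EOfRecord₁₃ F N θ) (wOfRecord₉ F N θ.toStage9Params) θ.ppSel p
              (gOfRecord₁₃ F N θ p) (k + 1) s V' =
            sect2Slot F N (FluctV N) p.K (settingOfRecord₁₃ F N θ p) Rz' W s t' Ek' U' V' :=
  Or.inr (slotsT_succ_ae_eq_sect2Slot_of_zetaSpecChiAt θ p hk s hΩ W Rz t Ek U hid Rz' t' Ek' U' hcκ hbranch hζχ hm hC)

/-- **★ CLAUSE-KEYED**: if the §2 DICHOTOMY (absent slot OR identity on the support) holds at `init s′` — the shape of `SLaw k`'s clause — then the 𝐓-image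
dichotomy holds at `s′` (the `slot_k(init s′) = 0` branch gives `slotT_{k+1}(s′) = 0`: def-T's transport of the zero integrand).
[cite: Balaban1988Convergent, (2.17)–(2.18) p.257, (3.1) p.264, (3.25) p.270] -/
theorem clause_succ_of_zetaSpecChiAt_of_clause {k : ℕ} (hk : k < p.K)
    (s : SeqOfRecord F θ.ν θ.τ9.M (gOfRecord₁₃ F N θ p) p.K (k + 1)) (hΩ : s.Ω (k + 1) = ∅) (W : TkWeights F N (FluctV N) p.K)
    (Rz : Sect2.Residual (F.P p.K) (MatA N))
    (t : Sect2.TermValues (F.P p.K) (MatA N) (FluctV N) θ.τ9.M) (Ek : ℝ) (U : BgMap F N p.K)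
    (hid : slotsOfRecord F N θ.ν θ.τ9 (EOfRecord₁₃ F N θ) (wOfRecord₉ F N θ.toStage9Params) θ.ppSel p (gOfRecord₁₃ F N θ p) k s.init = 0 ∨
      ∀ᵐ U₀ ∂fieldMeasure (F.P p.K) k (SU N),
        chiSeqOfRecord F N θ.ν θ.τ9.M (gOfRecord₁₃ F N θ p) p.K k s.init U₀ ≠ 0 →
          slotsOfRecord F N θ.ν θ.τ9 (EOfRecord₁₃ F N θ) (wOfRecord₉ F N θ.toStage9Params) θ.ppSel p
              (gOfRecord₁₃ F N θ p) k s.init U₀ =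
            sect2Slot F N (FluctV N) p.K (settingOfRecord₁₃ F N θ p) Rz W s.init t Ek U U₀)
    (Rz' : Sect2.Residual (F.P p.K) (MatA N))
    (t' : Sect2.TermValues (F.P p.K) (MatA N) (FluctV N) θ.τ9.M) (Ek' : ℝ) (U' : BgMap F N p.K)
    {κ c C : ℝ} (hcκ : c * κ = 1)
    (hbranch : ∀ S ∈ admSOfRecord F θ.ν θ.τ9.M (gOfRecord₁₃ F N θ p) p.K k s.init,
      ∀ (V' : GaugeField (F.P p.K) (k + 1) (SU N)) (U₀ : GaugeField (F.P p.K) k (SU N)),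
        tkBranchOfRecord F N (FluctV N) θ.ν θ.τ9.M _ p.K W s.init S k
            (fun ω => sect2Operand F N (FluctV N) p.K (settingOfRecord₁₃ F N θ p) Rz' s t' Ek' U' (S, fun j => (ω j).2) (fun j => (ω j).1))
            (pairCfgAt (V := FluctV N) k V' U₀) =
          κ * tkBranchOfRecord F N (FluctV N) θ.ν θ.τ9.M _ p.K W s.init S k
            (fun ω => sect2Operand F N (FluctV N) p.K (settingOfRecord₁₃ F N θ p) Rz s.init t Ek U (S, fun j => (ω j).2) (fun j => (ω j).1))
            (baseCfg k U₀))
    (hζχ : ∀ U₀ : GaugeField (F.P p.K) k (SU N),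
      W.ζ k Set.univ (pairCfgAt (V := FluctV N) k ((avOfRecord F N p.K k).avg U₀) U₀) *
          W.w k ∅ ∅ ∅ (pairCfgAt (V := FluctV N) k ((avOfRecord F N p.K k).avg U₀) U₀) =
        c * (chiSeqOfRecord F N θ.ν θ.τ9.M (gOfRecord₁₃ F N θ p) p.K k s.init U₀ *
          wOfRecord₉ F N θ.toStage9Params p (gOfRecord₁₃ F N θ p) k s U₀ ((avOfRecord F N p.K k).avg U₀)))
    (hm : ∀ S ∈ admSOfRecord F θ.ν θ.τ9.M (gOfRecord₁₃ F N θ p) p.K k s.init,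
      Measurable (Function.uncurry (noExpIntegrandAt F N (FluctV N) p.K k W
        (tkBranchOfRecord F N (FluctV N) θ.ν θ.τ9.M _ p.K W s.init S k
          (fun ω => sect2Operand F N (FluctV N) p.K (settingOfRecord₁₃ F N θ p) Rz' s t' Ek' U' (S, fun j => (ω j).2) (fun j => (ω j).1))))))
    (hC : ∀ S ∈ admSOfRecord F θ.ν θ.τ9.M (gOfRecord₁₃ F N θ p) p.K k s.init, ∀ V' U₀,
      |noExpIntegrandAt F N (FluctV N) p.K k W
        (tkBranchOfRecord F N (FluctV N) θ.ν θ.τ9.M _ p.K W s.init S k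
          (fun ω => sect2Operand F N (FluctV N) p.K (settingOfRecord₁₃ F N θ p) Rz' s t' Ek' U' (S, fun j => (ω j).2) (fun j => (ω j).1)))
        V' U₀| ≤ C) :
    slotsTOfRecord F N θ.ν θ.τ9 (EOfRecord₁₃ F N θ) (wOfRecord₉ F N θ.toStage9Params) θ.ppSel p (gOfRecord₁₃ F N θ p) (k + 1) s = 0 ∨
      ∀ᵐ V' ∂fieldMeasure (F.P p.K) (k + 1) (SU N),
        chiSeqOfRecord F N θ.ν θ.τ9.M (gOfRecord₁₃ F N θ p) p.K (k + 1) s V' ≠ 0 →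
          slotsTOfRecord F N θ.ν θ.τ9 (EOfRecord₁₃ F N θ) (wOfRecord₉ F N θ.toStage9Params) θ.ppSel p
              (gOfRecord₁₃ F N θ p) (k + 1) s V' =
            sect2Slot F N (FluctV N) p.K (settingOfRecord₁₃ F N θ p) Rz' W s t' Ek' U' V' := by
  rcases hid with h0 | hid
  · -- absent slot at `init s′` ⇒ absent pre-𝐑 slot at `s′`
    refine Or.inl ?_
    funext V'
    rw [slotsTOfRecord_succ_apply, h0]
    show transportOfRecord F N p.K k (fun U => _ * (_ * (0 : ℝ))) V' = 0
    simp only [mul_zero]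
    show T4AveragingDisintegration.kernelTransport _ _ _ (fun _ => (0 : ℝ)) V' = 0
    simp only [T4AveragingDisintegration.kernelTransport, integral_zero, mul_zero]
  · exact hasSect2FormAtZ_clause_succ_of_zetaSpecChiAt θ p hk s hΩ W Rz t Ek U hid Rz' t' Ek' U' hcκ hbranch hζχ hm hC

end Positive

end Summit.QuantumFields.YangMills.Theorems.BalabanUVNodesN11NoExpansionGeneralStep

end
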